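import Mathlib
import Summits.RiemannHypothesis.RiemannHypothesis.Theorems.WeilFarFloorZeroEnergyCells
import Literature.NumberTheory.LFunctions.WeilArchimedeanMoments
import HarnessLib

/-!
# Plancherel on the critical line for Weil tests, and the zero energy under RH from `L²` data and a quadratic modulus

Helper file (`--supports stmt-RiemannHypothesis-0098`, lead-track anchor: Weil-positivity window ladder, format-C far bound),
pure proofs over BUILT imports.  Seat rh-explicit-weil-1 gen15 (memo `run/shared/lean/pub/rh-explicit/rh-explicit-weil-1/FORMAT-K3.md`
§16.4): second input of the LOWER half of the second-order law.

* §1 `integral_norm_sq_weilMellin_half` — **Plancherel on the critical line** (the Literature layer's `integral_norm_sq_weilMellin_half_line`): for a Weil test `g`,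
  `∫ ‖ĝ(½+it)‖² dt = 2π ∫ ‖g‖²` (and integrability).
* §2 `norm_sq_weilMellin_shift_sub` — translation is modulation: `‖(g(·+h) − g)^(½+it)‖² = (2 − 2cos(th))‖ĝ(½+it)‖²`, hence
  `setIntegral_sq_mul_norm_sq_weilMellin_le` — **`∫_{[−T,T]} t²‖ĝ(½+it)‖² dt ≤ (48/43)·2π·D_h(g)/h²`** for `0 < h ≤ 1/T`
  (`D_h(g) = ∫‖g(x+h) − g(x)‖²`; `2 − 2cos θ ≥ (43/48)θ²` on `|θ| ≤ 1`, `Real.cos_bound`).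
* §3 ★ `weilQuadratic_re_le_of_quadraticModulus_of_RH` — with the cell bound of `WeilFarFloorZeroEnergyCells`: under RH, for a Weil
  test `g` with `D_h(g) ≤ M·h²` and `D_h(x·g) ≤ M₁·h²` for `0 < h ≤ h₀`, and every `T₀ ≥ 1`,
  **`Re Q(g) ≤ C_w·2π·[(log(T₀+3) + 1/T₀)·(2∫‖g‖² + ∫‖xg‖²) + (48/43)(2M + M₁)/T₀]`** — the zero energy is `O(log T₀)` times the
  `L²` data plus a quadratic-modulus tail that `T₀` kills.  For the smoothed residual of the floor gap (`M ≍ ‖r‖²/σ²`, `T₀ = e^{κa}`)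
  this is `O(a³)·‖v‖²` — negligible against `R_c ≍ e^a` (the use is `WeilFarFloorSecondOrderLowerRH`).
Standard axioms only; RH enters §3 as Mathlib's `RiemannHypothesis`.
-/

set_option linter.dupNamespace false
set_option autoImplicit false

noncomputable section

open MeasureTheory Set Filter Complex
open scoped Real Topology FourierTransform

namespace Summit.RiemannHypothesis.RiemannHypothesis.Theorems.WeilFormatC

namespace FloorZeroEnergy

open Literature.NumberTheory.LFunctions

variable {g : ℝ → ℂ}

/-! ## §1 Plancherel on the critical line (from the Literature layer) -/

/-- **Plancherel on the critical line** for a Weil test `g`: `t ↦ ‖ĝ(½+it)‖²` is integrable and `∫ ‖ĝ(½+it)‖² dt = 2π·∫ ‖g‖²`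
(`Literature…WeilArchimedeanMoments.integral_norm_sq_weilMellin_half_line`, `integrable_norm_sq_weilMellin_half_line`; repackaged). -/
theorem integral_norm_sq_weilMellin_half (hg : IsWeilTest g) :
    Integrable (fun t : ℝ ↦ ‖weilMellin g (1 / 2 + t * I)‖ ^ 2) ∧
      ∫ t : ℝ, ‖weilMellin g (1 / 2 + t * I)‖ ^ 2 = 2 * π * ∫ x : ℝ, ‖g x‖ ^ 2 :=
  ⟨integrable_norm_sq_weilMellin_half_line hg, integral_norm_sq_weilMellin_half_line hg⟩

/-! ## §2 Translation is modulation; the `t²`-moment from the quadratic modulus -/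

/-- `‖e^{iθ} − 1‖² = 2 − 2cos θ`. -/
theorem norm_sq_exp_mul_I_sub_one (θ : ℝ) : ‖cexp (θ * I) - 1‖ ^ 2 = 2 - 2 * Real.cos θ := by
  rw [Complex.sq_norm, Complex.normSq_apply]
  simp only [Complex.sub_re, Complex.sub_im, Complex.one_re, Complex.one_im, Complex.exp_ofReal_mul_I_re,
    Complex.exp_ofReal_mul_I_im, sub_zero]
  nlinarith [Real.sin_sq_add_cos_sq θ]

/-- The increment `x ↦ g(x+h) − g(x)` of a Weil test is a Weil test (`= weilTranslate g (−h) + (−1)·g`). -/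
theorem isWeilTest_shift_sub (hg : IsWeilTest g) (h : ℝ) : IsWeilTest fun x ↦ g (x + h) - g x := by
  have h1 := (hg.weilTranslate (-h)).add (hg.const_mul (-1))
  have e : (weilTranslate g (-h) + fun t ↦ (-1) * g t) = fun x ↦ g (x + h) - g x := by
    funext x; simp only [Pi.add_apply, weilTranslate, sub_neg_eq_add]; ring
  rwa [e] at h1

/-- **Translation is modulation**: `(g(·+h) − g)^(½+it) = (e^{−ith} − 1)·ĝ(½+it)`, hence
`‖(g(·+h) − g)^(½+it)‖² = (2 − 2cos(th))·‖ĝ(½+it)‖²`, for a Weil test `g`. -/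
theorem norm_sq_weilMellin_shift_sub (hg : IsWeilTest g) (h t : ℝ) :
    ‖weilMellin (fun x ↦ g (x + h) - g x) (1 / 2 + t * I)‖ ^ 2
      = (2 - 2 * Real.cos (t * h)) * ‖weilMellin g (1 / 2 + t * I)‖ ^ 2 := by
  have htr : IsWeilTest (weilTranslate g (-h)) := hg.weilTranslate (-h)
  have hng : IsWeilTest fun t ↦ (-1 : ℂ) * g t := hg.const_mul (-1)
  have e : (fun x ↦ g (x + h) - g x) = (weilTranslate g (-h) + fun t ↦ (-1) * g t) := by
    funext x; simp only [Pi.add_apply, weilTranslate, sub_neg_eq_add]; ring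
  rw [e, weilMellin_add htr.1.continuous htr.2 hng.1.continuous hng.2, weilMellin_weilTranslate, weilMellin_const_mul]
  have e2 : cexp ((1 / 2 + (t : ℂ) * I - 1 / 2) * ((-h : ℝ) : ℂ)) * weilMellin g (1 / 2 + t * I)
        + (-1) * weilMellin g (1 / 2 + t * I)
      = (cexp (((-(t * h) : ℝ) : ℂ) * I) - 1) * weilMellin g (1 / 2 + t * I) := by
    have e3 : (1 / 2 + (t : ℂ) * I - 1 / 2) * ((-h : ℝ) : ℂ) = ((-(t * h) : ℝ) : ℂ) * I := by push_cast; ring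
    rw [e3]; ring
  rw [e2, norm_mul, mul_pow, norm_sq_exp_mul_I_sub_one, Real.cos_neg]

/-- `(43/48)θ² ≤ 2 − 2cos θ` for `|θ| ≤ 1` (`Real.cos_bound`). -/
theorem sq_le_two_sub_two_mul_cos {θ : ℝ} (hθ : |θ| ≤ 1) : 43 / 48 * θ ^ 2 ≤ 2 - 2 * Real.cos θ := by
  have h := Real.cos_bound hθ
  have h1 := (abs_le.1 h).2
  have h4 : |θ| ^ 4 ≤ θ ^ 2 := by
    have e : |θ| ^ 4 = θ ^ 2 * |θ| ^ 2 := by rw [show (4:ℕ) = 2 + 2 by norm_num, pow_add, sq_abs]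
    rw [e]
    have : |θ| ^ 2 ≤ 1 := by nlinarith [abs_nonneg θ]
    nlinarith [sq_nonneg θ]
  nlinarith [h1, h4]

/-- **The `t²`-moment of `‖ĝ(½+it)‖²` on `[−T, T]` from one increment**: for a Weil test `g`, `0 < h`, `h·T ≤ 1`:
`∫_{[−T,T]} t²‖ĝ(½+it)‖² dt ≤ (48/43)/h² · 2π·∫‖g(x+h) − g(x)‖² dx` (translation is modulation + Plancherel). -/
theorem setIntegral_sq_mul_norm_sq_weilMellin_le (hg : IsWeilTest g) {T h : ℝ} (hh : 0 < h) (hhT : h * T ≤ 1) :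
    ∫ t in Icc (-T) T, t ^ 2 * ‖weilMellin g (1 / 2 + t * I)‖ ^ 2
      ≤ (48 / 43) / h ^ 2 * (2 * π * ∫ x : ℝ, ‖g (x + h) - g x‖ ^ 2) := by
  -- the increment `d = g(·+h) − g` is a Weil test; Plancherel for it
  have hd : IsWeilTest (fun x ↦ g (x + h) - g x) := isWeilTest_shift_sub hg h
  obtain ⟨hdi, hdP⟩ := integral_norm_sq_weilMellin_half hd
  -- pointwise on `[−T, T]`: `t²F ≤ (48/43)h⁻²·(2 − 2cos(th))F = (48/43)h⁻²‖d̂‖²`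
  have hpt : ∀ t ∈ Icc (-T) T, t ^ 2 * ‖weilMellin g (1 / 2 + t * I)‖ ^ 2
      ≤ (48 / 43) / h ^ 2 * ‖weilMellin (fun x ↦ g (x + h) - g x) (1 / 2 + t * I)‖ ^ 2 := by
    intro t ht
    rw [norm_sq_weilMellin_shift_sub hg h t]
    have hθ : |t * h| ≤ 1 := by
      rw [abs_mul, abs_of_pos hh]
      have : |t| ≤ T := abs_le.2 ⟨ht.1, ht.2⟩
      nlinarith [abs_nonneg t]
    have hc := sq_le_two_sub_two_mul_cos hθ
    have hF0 : 0 ≤ ‖weilMellin g (1 / 2 + t * I)‖ ^ 2 := sq_nonneg _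
    have h2 : t ^ 2 ≤ (48 / 43) / h ^ 2 * (2 - 2 * Real.cos (t * h)) := by
      rw [div_mul_eq_mul_div, le_div_iff₀ (by positivity)]
      nlinarith [hc]
    nlinarith [h2, hF0]
  have hcont : Continuous fun t : ℝ ↦ t ^ 2 * ‖weilMellin g (1 / 2 + t * I)‖ ^ 2 :=
    (continuous_id.pow 2).mul ((continuous_weilMellin_line hg).norm.pow 2)
  calc ∫ t in Icc (-T) T, t ^ 2 * ‖weilMellin g (1 / 2 + t * I)‖ ^ 2
      ≤ ∫ t in Icc (-T) T, (48 / 43) / h ^ 2 * ‖weilMellin (fun x ↦ g (x + h) - g x) (1 / 2 + t * I)‖ ^ 2 :=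
        setIntegral_mono_on hcont.continuousOn.integrableOn_Icc (hdi.const_mul _).integrableOn measurableSet_Icc hpt
    _ = (48 / 43) / h ^ 2 * ∫ t in Icc (-T) T, ‖weilMellin (fun x ↦ g (x + h) - g x) (1 / 2 + t * I)‖ ^ 2 :=
        integral_const_mul _ _
    _ ≤ (48 / 43) / h ^ 2 * ∫ t : ℝ, ‖weilMellin (fun x ↦ g (x + h) - g x) (1 / 2 + t * I)‖ ^ 2 :=
        mul_le_mul_of_nonneg_left (setIntegral_le_integral hdi (Eventually.of_forall fun t ↦ sq_nonneg _))
          (by positivity)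
    _ = (48 / 43) / h ^ 2 * (2 * π * ∫ x : ℝ, ‖g (x + h) - g x‖ ^ 2) := by rw [hdP]

/-! ## §3 The cell sums from `L²` data and quadratic moduli; the zero energy under RH -/

/-- `log(|t| + 3) ≤ log(T₀ + 3) + (1 + t²)/(2T₀)` for `T₀ ≥ 1` (concavity of `log` and `|t| ≤ (1+t²)/2`). -/
theorem log_abs_add_three_le {T₀ : ℝ} (hT₀ : 1 ≤ T₀) (t : ℝ) :
    Real.log (|t| + 3) ≤ Real.log (T₀ + 3) + (1 + t ^ 2) / (2 * T₀) := by
  have h0 : 0 < T₀ + 3 := by linarith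
  have h1 : Real.log (|t| + 3) - Real.log (T₀ + 3) ≤ |t| / T₀ := by
    rw [← Real.log_div (by positivity) h0.ne']
    have h2 := Real.log_le_sub_one_of_pos (show 0 < (|t| + 3) / (T₀ + 3) by positivity)
    have h3 : (|t| + 3) / (T₀ + 3) - 1 ≤ |t| / T₀ := by
      rw [div_sub_one h0.ne', div_le_div_iff₀ h0 (by linarith)]
      nlinarith [abs_nonneg t]
    linarith
  have h4 : |t| / T₀ ≤ (1 + t ^ 2) / (2 * T₀) := by
    rw [div_le_div_iff₀ (by linarith) (by linarith)]
    nlinarith [sq_nonneg (|t| - 1), sq_abs t, abs_nonneg t]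
  linarith

/-- **THE CELL SUMS FROM `L²` DATA AND QUADRATIC MODULI.**  For a Weil test `g` with `∫‖g(x+h) − g(x)‖² ≤ M h²` and
`∫‖(x+h)g(x+h) − xg(x)‖² ≤ M₁h²` for `0 < h ≤ h₀`, every `T₀ ≥ 1` and every finite `K ⊆ ℤ`:
`Σ_{k∈K} ψ_g(k) log(|k|+2) ≤ 2π·[(log(T₀+3) + 1/(2T₀))·(2∫‖g‖² + ∫x²‖g‖²) + (24/43)(2M + M₁)/T₀]`
(`ψ_g` the cell integrals of `WeilFarFloorZeroEnergyCells`; Plancherel for `g`, `xg`, the `t²`-moments from the moduli). -/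
theorem cellSum_le_of_quadraticModulus (hg : IsWeilTest g) {M M₁ h₀ T₀ : ℝ} (hh₀ : 0 < h₀) (hT₀ : 1 ≤ T₀)
    (hM : ∀ h : ℝ, 0 < h → h ≤ h₀ → ∫ x : ℝ, ‖g (x + h) - g x‖ ^ 2 ≤ M * h ^ 2)
    (hM₁ : ∀ h : ℝ, 0 < h → h ≤ h₀ → ∫ x : ℝ, ‖((x + h : ℝ) : ℂ) * g (x + h) - (x : ℂ) * g x‖ ^ 2 ≤ M₁ * h ^ 2)
    (K : Finset ℤ) :
    ∑ k ∈ K, (∫ s in Icc ((k : ℝ) - 1 / 2) ((k : ℝ) + 1 / 2),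
        (‖weilMellin g (1 / 2 + s * I)‖ ^ 2
          + 2 * ‖weilMellin g (1 / 2 + s * I)‖ * ‖weilMellin (fun x : ℝ ↦ I * x * g x) (1 / 2 + s * I)‖))
        * Real.log (|(k : ℝ)| + 2)
      ≤ 2 * π * ((Real.log (T₀ + 3) + 1 / (2 * T₀)) * (2 * (∫ x : ℝ, ‖g x‖ ^ 2) + ∫ x : ℝ, x ^ 2 * ‖g x‖ ^ 2)
          + 24 / 43 * (2 * M + M₁) / T₀) := by
  have hg₁ : IsWeilTest fun x : ℝ ↦ I * x * g x := hg.I_mul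
  -- the two spectral densities and their Plancherel identities
  obtain ⟨F, hF⟩ : ∃ F : ℝ → ℝ, F = fun t : ℝ ↦ ‖weilMellin g (1 / 2 + t * I)‖ ^ 2 := ⟨_, rfl⟩
  obtain ⟨F₁, hF₁⟩ : ∃ F₁ : ℝ → ℝ, F₁ = fun t : ℝ ↦ ‖weilMellin (fun x : ℝ ↦ I * x * g x) (1 / 2 + t * I)‖ ^ 2 :=
    ⟨_, rfl⟩
  have hFc : Continuous F := by rw [hF]; exact (continuous_weilMellin_line hg).norm.pow 2
  have hF₁c : Continuous F₁ := by rw [hF₁]; exact (continuous_weilMellin_line hg₁).norm.pow 2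
  have hF0 : ∀ t, 0 ≤ F t := fun t ↦ by rw [hF]; positivity
  have hF₁0 : ∀ t, 0 ≤ F₁ t := fun t ↦ by rw [hF₁]; positivity
  obtain ⟨hFi, hFP⟩ := integral_norm_sq_weilMellin_half hg
  obtain ⟨hF₁i, hF₁P⟩ := integral_norm_sq_weilMellin_half hg₁
  rw [← hF] at hFi hFP
  rw [← hF₁] at hF₁i hF₁P
  have hxg : ∫ x : ℝ, ‖I * (x : ℂ) * g x‖ ^ 2 = ∫ x : ℝ, x ^ 2 * ‖g x‖ ^ 2 :=
    integral_congr_ae (Eventually.of_forall fun x ↦ by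
      simp only [norm_mul, Complex.norm_I, one_mul, Complex.norm_real, Real.norm_eq_abs, mul_pow, sq_abs])
  rw [hxg] at hF₁P
  set Ng := ∫ x : ℝ, ‖g x‖ ^ 2 with hNg
  set Nx := ∫ x : ℝ, x ^ 2 * ‖g x‖ ^ 2 with hNx
  have hNg0 : 0 ≤ Ng := integral_nonneg fun x ↦ by positivity
  have hNx0 : 0 ≤ Nx := integral_nonneg fun x ↦ by positivity
  -- the weight and the majorant density `Φ = 2F + F₁`
  set L₀ := Real.log (T₀ + 3) with hL₀
  have hL₀0 : 0 ≤ L₀ := Real.log_nonneg (by linarith)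
  set w : ℝ → ℝ := fun t ↦ L₀ + (1 + t ^ 2) / (2 * T₀) with hw
  have hw0 : ∀ t, 0 ≤ w t := fun t ↦ by rw [hw]; positivity
  have hwc : Continuous w := by rw [hw]; fun_prop
  set Φ : ℝ → ℝ := fun t ↦ 2 * F t + F₁ t with hΦ
  have hΦc : Continuous Φ := by rw [hΦ]; exact (continuous_const.mul hFc).add hF₁c
  have hΦ0 : ∀ t, 0 ≤ Φ t := fun t ↦ by rw [hΦ]; linarith [hF0 t, hF₁0 t]
  have hΦi : Integrable Φ := by rw [hΦ]; exact (hFi.const_mul 2).add hF₁i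
  have hΦint : ∫ t, Φ t = 2 * π * (2 * Ng + Nx) := by
    rw [hΦ, integral_add (hFi.const_mul 2) hF₁i, integral_const_mul, hFP, hF₁P]; ring
  -- the bounding window `[−T, T]` containing all cells of `K`, and the increment `h`
  set T : ℝ := (K.sup fun k : ℤ ↦ k.natAbs : ℕ) + 1 with hT
  have hT1 : 1 ≤ T := by rw [hT]; have : (0:ℝ) ≤ (K.sup fun k : ℤ ↦ k.natAbs : ℕ) := Nat.cast_nonneg _; linarith
  have hT0 : 0 < T := by linarith
  have hcellT : ∀ k ∈ K, Icc ((k : ℝ) - 1 / 2) ((k : ℝ) + 1 / 2) ⊆ Icc (-T) T := by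
    intro k hk
    have h1 : (k.natAbs : ℝ) ≤ (K.sup fun k : ℤ ↦ k.natAbs : ℕ) := by
      exact_mod_cast Finset.le_sup (f := fun k : ℤ ↦ k.natAbs) hk
    have h2 : |(k : ℝ)| = (k.natAbs : ℝ) := by
      rw [← Int.cast_abs, Int.abs_eq_natAbs, Int.cast_natCast]
    have h3 : |(k : ℝ)| ≤ T - 1 := by rw [h2, hT]; linarith
    rw [abs_le] at h3
    intro t ht
    exact ⟨by linarith [ht.1, h3.1], by linarith [ht.2, h3.2]⟩
  set h := min h₀ (1 / T) with hh
  have hh0 : 0 < h := by rw [hh]; exact lt_min hh₀ (by positivity)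
  have hhh₀ : h ≤ h₀ := min_le_left _ _
  have hhT : h * T ≤ 1 := by
    have : h ≤ 1 / T := min_le_right _ _
    rw [le_div_iff₀ hT0] at this; linarith
  -- the `t²`-moments on `[−T, T]`
  have hmF : ∫ t in Icc (-T) T, t ^ 2 * F t ≤ 48 / 43 * (2 * π) * M := by
    have h1 := setIntegral_sq_mul_norm_sq_weilMellin_le hg (T := T) hh0 hhT
    rw [hF]
    have h2 := hM h hh0 hhh₀
    have h3 : (48 / 43) / h ^ 2 * (2 * π * ∫ x : ℝ, ‖g (x + h) - g x‖ ^ 2)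
        ≤ (48 / 43) / h ^ 2 * (2 * π * (M * h ^ 2)) := by
      have := mul_le_mul_of_nonneg_left h2 (by positivity : (0:ℝ) ≤ 2 * π)
      exact mul_le_mul_of_nonneg_left this (by positivity)
    have e : (48 / 43) / h ^ 2 * (2 * π * (M * h ^ 2)) = 48 / 43 * (2 * π) * M := by
      field_simp
    linarith [h1, h3, e.le]
  have hmF₁ : ∫ t in Icc (-T) T, t ^ 2 * F₁ t ≤ 48 / 43 * (2 * π) * M₁ := by
    have h1 := setIntegral_sq_mul_norm_sq_weilMellin_le hg₁ (T := T) hh0 hhT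
    rw [hF₁]
    have hinc : ∫ x : ℝ, ‖I * ((x + h : ℝ) : ℂ) * g (x + h) - I * (x : ℂ) * g x‖ ^ 2
        = ∫ x : ℝ, ‖((x + h : ℝ) : ℂ) * g (x + h) - (x : ℂ) * g x‖ ^ 2 :=
      integral_congr_ae (Eventually.of_forall fun x ↦ by
        show ‖I * ((x + h : ℝ) : ℂ) * g (x + h) - I * (x : ℂ) * g x‖ ^ 2 = ‖((x + h : ℝ) : ℂ) * g (x + h) - (x : ℂ) * g x‖ ^ 2
        rw [show I * ((x + h : ℝ) : ℂ) * g (x + h) - I * (x : ℂ) * g x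
            = I * (((x + h : ℝ) : ℂ) * g (x + h) - (x : ℂ) * g x) by ring, norm_mul, Complex.norm_I, one_mul])
    rw [hinc] at h1
    have h2 := hM₁ h hh0 hhh₀
    have h3 : (48 / 43) / h ^ 2 * (2 * π * ∫ x : ℝ, ‖((x + h : ℝ) : ℂ) * g (x + h) - (x : ℂ) * g x‖ ^ 2)
        ≤ (48 / 43) / h ^ 2 * (2 * π * (M₁ * h ^ 2)) := by
      have := mul_le_mul_of_nonneg_left h2 (by positivity : (0:ℝ) ≤ 2 * π)
      exact mul_le_mul_of_nonneg_left this (by positivity)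
    have e : (48 / 43) / h ^ 2 * (2 * π * (M₁ * h ^ 2)) = 48 / 43 * (2 * π) * M₁ := by
      field_simp
    linarith [h1, h3, e.le]
  -- per cell: `ψ(k)·log(|k|+2) ≤ ∫_{cell} Φ·w`
  have hcell : ∀ k ∈ K, (∫ s in Icc ((k : ℝ) - 1 / 2) ((k : ℝ) + 1 / 2),
        (‖weilMellin g (1 / 2 + s * I)‖ ^ 2
          + 2 * ‖weilMellin g (1 / 2 + s * I)‖ * ‖weilMellin (fun x : ℝ ↦ I * x * g x) (1 / 2 + s * I)‖))
        * Real.log (|(k : ℝ)| + 2)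
      ≤ ∫ s in Ioc ((k : ℝ) - 1 / 2) ((k : ℝ) + 1 / 2), Φ s * w s := by
    intro k _
    rw [setIntegral_congr_set Ioc_ae_eq_Icc, ← integral_mul_const]
    have hi1 : IntegrableOn (fun s : ℝ ↦ (‖weilMellin g (1 / 2 + s * I)‖ ^ 2
          + 2 * ‖weilMellin g (1 / 2 + s * I)‖ * ‖weilMellin (fun x : ℝ ↦ I * x * g x) (1 / 2 + s * I)‖)
          * Real.log (|(k : ℝ)| + 2)) (Icc ((k : ℝ) - 1 / 2) ((k : ℝ) + 1 / 2)) := by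
      refine Continuous.continuousOn ?_ |>.integrableOn_Icc
      exact ((((continuous_weilMellin_line hg).norm.pow 2).add
        ((continuous_const.mul (continuous_weilMellin_line hg).norm).mul (continuous_weilMellin_line hg₁).norm)).mul
        continuous_const)
    have hi2 : IntegrableOn (fun s : ℝ ↦ Φ s * w s) (Icc ((k : ℝ) - 1 / 2) ((k : ℝ) + 1 / 2)) :=
      (hΦc.mul hwc).continuousOn.integrableOn_Icc
    refine setIntegral_mono_on hi1 hi2 measurableSet_Icc fun s hs ↦ ?_
    -- `log(|k|+2) ≤ log(|s|+3) ≤ w(s)` and `F + 2‖G‖‖G₁‖ ≤ 2F + F₁`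
    have hlog : Real.log (|(k : ℝ)| + 2) ≤ w s := by
      have h1 : |(k : ℝ)| ≤ |s| + 1 / 2 := by
        have := abs_sub_abs_le_abs_sub (k : ℝ) s
        have h2 : |(k : ℝ) - s| ≤ 1 / 2 := abs_le.2 ⟨by linarith [hs.2], by linarith [hs.1]⟩
        linarith
      have h2 : Real.log (|(k : ℝ)| + 2) ≤ Real.log (|s| + 3) :=
        Real.log_le_log (by positivity) (by linarith)
      exact h2.trans (log_abs_add_three_le hT₀ s)
    have hlog0 : 0 ≤ Real.log (|(k : ℝ)| + 2) := Real.log_nonneg (by linarith [abs_nonneg (k : ℝ)])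
    have hGG : ‖weilMellin g (1 / 2 + s * I)‖ ^ 2
          + 2 * ‖weilMellin g (1 / 2 + s * I)‖ * ‖weilMellin (fun x : ℝ ↦ I * x * g x) (1 / 2 + s * I)‖ ≤ Φ s := by
      rw [hΦ, hF, hF₁]
      nlinarith [sq_nonneg (‖weilMellin g (1 / 2 + s * I)‖ - ‖weilMellin (fun x : ℝ ↦ I * x * g x) (1 / 2 + s * I)‖)]
    have hA0 : 0 ≤ ‖weilMellin g (1 / 2 + s * I)‖ ^ 2
          + 2 * ‖weilMellin g (1 / 2 + s * I)‖ * ‖weilMellin (fun x : ℝ ↦ I * x * g x) (1 / 2 + s * I)‖ := by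
      positivity
    exact mul_le_mul hGG hlog hlog0 (hΦ0 s)
  -- the cells are disjoint half-open intervals inside `[−T, T]`
  have hdisj : Set.Pairwise (↑K : Set ℤ) (Function.onFun Disjoint fun k : ℤ ↦ Ioc ((k : ℝ) - 1 / 2) ((k : ℝ) + 1 / 2)) := by
    intro k _ k' _ hkk
    simp only [Function.onFun]
    rw [Set.Ioc_disjoint_Ioc]
    rcases lt_or_gt_of_ne hkk with hlt | hgt
    · have : (k : ℝ) + 1 ≤ k' := by exact_mod_cast hlt
      rw [min_le_iff, le_max_iff]; left; right; linarith
    · have : (k' : ℝ) + 1 ≤ k := by exact_mod_cast hgt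
      rw [min_le_iff, le_max_iff, le_max_iff]; right; left; linarith
  have hunion : ∑ k ∈ K, ∫ s in Ioc ((k : ℝ) - 1 / 2) ((k : ℝ) + 1 / 2), Φ s * w s
      = ∫ s in ⋃ k ∈ K, Ioc ((k : ℝ) - 1 / 2) ((k : ℝ) + 1 / 2), Φ s * w s :=
    (integral_biUnion_finset K (fun k _ ↦ measurableSet_Ioc) hdisj
      (fun k _ ↦ (hΦc.mul hwc).continuousOn.integrableOn_Icc.mono_set Ioc_subset_Icc_self)).symm
  have hsub : (⋃ k ∈ K, Ioc ((k : ℝ) - 1 / 2) ((k : ℝ) + 1 / 2)) ⊆ Icc (-T) T :=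
    Set.iUnion₂_subset fun k hk ↦ Ioc_subset_Icc_self.trans (hcellT k hk)
  have hIccI : IntegrableOn (fun s ↦ Φ s * w s) (Icc (-T) T) := (hΦc.mul hwc).continuousOn.integrableOn_Icc
  have hstep1 : ∫ s in ⋃ k ∈ K, Ioc ((k : ℝ) - 1 / 2) ((k : ℝ) + 1 / 2), Φ s * w s ≤ ∫ s in Icc (-T) T, Φ s * w s :=
    setIntegral_mono_set hIccI (Eventually.of_forall fun s ↦ mul_nonneg (hΦ0 s) (hw0 s)) (Eventually.of_forall hsub)
  -- `∫_{[−T,T]} Φ·w = L₀∫Φ + (1/(2T₀))(∫Φ + ∫t²Φ)` on `[−T,T]`, each piece bounded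
  have hΦIcc : IntegrableOn Φ (Icc (-T) T) := hΦc.continuousOn.integrableOn_Icc
  have ht2Φ : IntegrableOn (fun t ↦ t ^ 2 * Φ t) (Icc (-T) T) := ((continuous_id.pow 2).mul hΦc).continuousOn.integrableOn_Icc
  have hsplit : ∫ s in Icc (-T) T, Φ s * w s
      = L₀ * (∫ s in Icc (-T) T, Φ s) + (1 / (2 * T₀)) * ((∫ s in Icc (-T) T, Φ s) + ∫ s in Icc (-T) T, s ^ 2 * Φ s) := by
    have e : (fun s ↦ Φ s * w s) = fun s ↦ L₀ * Φ s + (1 / (2 * T₀)) * (Φ s + s ^ 2 * Φ s) := by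
      funext s; rw [hw]; ring
    have i1 : IntegrableOn (fun s : ℝ ↦ L₀ * Φ s) (Icc (-T) T) := hΦIcc.const_mul _
    have i2 : IntegrableOn (fun s : ℝ ↦ Φ s + s ^ 2 * Φ s) (Icc (-T) T) := hΦIcc.add ht2Φ
    have i3 : IntegrableOn (fun s : ℝ ↦ (1 / (2 * T₀)) * (Φ s + s ^ 2 * Φ s)) (Icc (-T) T) := i2.const_mul _
    rw [e, integral_add i1 i3, integral_const_mul, integral_const_mul, integral_add hΦIcc ht2Φ]
  have hΦIcc_le : ∫ s in Icc (-T) T, Φ s ≤ 2 * π * (2 * Ng + Nx) := by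
    rw [← hΦint]; exact setIntegral_le_integral hΦi (Eventually.of_forall hΦ0)
  have ht2 : ∫ s in Icc (-T) T, s ^ 2 * Φ s ≤ 48 / 43 * (2 * π) * (2 * M + M₁) := by
    have hFIcc : IntegrableOn (fun t ↦ t ^ 2 * F t) (Icc (-T) T) := ((continuous_id.pow 2).mul hFc).continuousOn.integrableOn_Icc
    have hF₁Icc : IntegrableOn (fun t ↦ t ^ 2 * F₁ t) (Icc (-T) T) :=
      ((continuous_id.pow 2).mul hF₁c).continuousOn.integrableOn_Icc
    have e : (fun s : ℝ ↦ s ^ 2 * Φ s) = fun s ↦ 2 * (s ^ 2 * F s) + s ^ 2 * F₁ s := by funext s; rw [hΦ]; ring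
    have i1 : IntegrableOn (fun s : ℝ ↦ 2 * (s ^ 2 * F s)) (Icc (-T) T) := hFIcc.const_mul 2
    rw [e, integral_add i1 hF₁Icc, integral_const_mul]
    linarith [hmF, hmF₁]
  have hT₀0 : 0 < T₀ := by linarith
  calc ∑ k ∈ K, (∫ s in Icc ((k : ℝ) - 1 / 2) ((k : ℝ) + 1 / 2),
          (‖weilMellin g (1 / 2 + s * I)‖ ^ 2
            + 2 * ‖weilMellin g (1 / 2 + s * I)‖ * ‖weilMellin (fun x : ℝ ↦ I * x * g x) (1 / 2 + s * I)‖))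
          * Real.log (|(k : ℝ)| + 2)
      ≤ ∑ k ∈ K, ∫ s in Ioc ((k : ℝ) - 1 / 2) ((k : ℝ) + 1 / 2), Φ s * w s := Finset.sum_le_sum hcell
    _ ≤ ∫ s in Icc (-T) T, Φ s * w s := by rw [hunion]; exact hstep1
    _ ≤ 2 * π * ((Real.log (T₀ + 3) + 1 / (2 * T₀)) * (2 * Ng + Nx) + 24 / 43 * (2 * M + M₁) / T₀) := by
        rw [hsplit, ← hL₀]
        have h1 : L₀ * (∫ s in Icc (-T) T, Φ s) ≤ L₀ * (2 * π * (2 * Ng + Nx)) := mul_le_mul_of_nonneg_left hΦIcc_le hL₀0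
        have h2 : (1 / (2 * T₀)) * ((∫ s in Icc (-T) T, Φ s) + ∫ s in Icc (-T) T, s ^ 2 * Φ s)
            ≤ (1 / (2 * T₀)) * (2 * π * (2 * Ng + Nx) + 48 / 43 * (2 * π) * (2 * M + M₁)) :=
          mul_le_mul_of_nonneg_left (by linarith [hΦIcc_le, ht2]) (by positivity)
        have e : L₀ * (2 * π * (2 * Ng + Nx)) + (1 / (2 * T₀)) * (2 * π * (2 * Ng + Nx) + 48 / 43 * (2 * π) * (2 * M + M₁))
            = 2 * π * ((L₀ + 1 / (2 * T₀)) * (2 * Ng + Nx) + 24 / 43 * (2 * M + M₁) / T₀) := by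
          field_simp; ring
        linarith [h1, h2, e.le]

/-- ★ **THE ZERO ENERGY UNDER RH FROM `L²` DATA AND QUADRATIC MODULI.**  There is a universal `C > 0` such that for every Weil
test `g`, under RH: if `∫‖g(x+h) − g(x)‖² ≤ M h²` and `∫‖(x+h)g(x+h) − xg(x)‖² ≤ M₁h²` for `0 < h ≤ h₀`, then for every `T₀ ≥ 1`
`Re Q(g) ≤ C·2π·[(log(T₀+3) + 1/(2T₀))·(2∫‖g‖² + ∫x²‖g‖²) + (24/43)(2M + M₁)/T₀]`. -/
theorem weilQuadratic_re_le_of_quadraticModulus_of_RH :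
    ∃ C : ℝ, 0 < C ∧ ∀ {g : ℝ → ℂ}, IsWeilTest g → RiemannHypothesis → ∀ {M M₁ h₀ T₀ : ℝ}, 0 < h₀ → 1 ≤ T₀ →
      (∀ h : ℝ, 0 < h → h ≤ h₀ → ∫ x : ℝ, ‖g (x + h) - g x‖ ^ 2 ≤ M * h ^ 2) →
      (∀ h : ℝ, 0 < h → h ≤ h₀ → ∫ x : ℝ, ‖((x + h : ℝ) : ℂ) * g (x + h) - (x : ℂ) * g x‖ ^ 2 ≤ M₁ * h ^ 2) →
      (weilQuadratic g).re
        ≤ C * (2 * π * ((Real.log (T₀ + 3) + 1 / (2 * T₀)) * (2 * (∫ x : ℝ, ‖g x‖ ^ 2) + ∫ x : ℝ, x ^ 2 * ‖g x‖ ^ 2)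
          + 24 / 43 * (2 * M + M₁) / T₀)) := by
  obtain ⟨C, hC0, hC⟩ := weilQuadratic_re_le_of_cellBound_of_RH
  exact ⟨C, hC0, fun hg hRH _ _ _ _ hh₀ hT₀ hM hM₁ ↦ hC hg hRH (cellSum_le_of_quadraticModulus hg hh₀ hT₀ hM hM₁)⟩

end FloorZeroEnergy

end Summit.RiemannHypothesis.RiemannHypothesis.Theorems.WeilFormatC
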